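/-
Copyright (c) 2026 the pub-hodgecm-mathlib formalisation cell (harness21).  Prover seat hodgecm-mathlib-K2E5-p16 (g3): Track B «K2-LIT»,
#184♮ = hLiu418 = stmt-HodgeConjecture-24832, LEAD F0P6-plan (g11) ruling «M-155j» deal J2 (second half), socket #31p′
`sig_K2LiuIwasawaDatumAdaptedStd` of `Cruxes/HLiu418/Lines/K2_Liu_CurveThetaSigs_U5d_ZetaS.lean` ED. 6 (typist K2Liu-plan (g3), cand 65fde94a4071edfc :176); 2026-09-04.
-/
import Summits.HodgeConjecture.HodgeConjecture.Theorems.K2LiuIwasawaDatumNonemptyStd       -- ★ J2 first half (this seat): `exists_subgroup_isStd_shape`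
import Summits.HodgeConjecture.HodgeConjecture.Theorems.K2LiuIwasawaDatumAdapted           -- ★ #31p (K2Liu-p06 g2): `exists_subgroup_adapted` ∕ `isCompact_adapted` ∕ `exists_isSiegelDelta_mul_mem_adapted`
import HarnessLib

/-!
# Crux `HLiu418`, Track B road `K2_Liu`, unit U5d «`Z_S`», socket #31p′: a STANDARD Iwasawa datum whose compact contains `K^S_H`

Cell `hodgecm-mathlib`, crux item hLiu418 = `stmt-HodgeConjecture-24832`, route of record `HCCMUnconditional`; squad K2, LEAD F0P6-plan (g11) (ruling
«M-155j», memo `F0/P6/F0P6-plan-g11/RULING-M155j-S7-IwasawaStd.v1.F0P6-plan-g11.md`, deal J2), typist K2Liu-plan (g3), prover K2E5-p16 (g3).  THEOREMS ONLY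
(no `def`, no instance, no notation, no named-fact hypothesis, no `sorry`); lane `--supports stmt-HodgeConjecture-24832 --as helper` (count-neutral helper).

WHAT IS PROVED.  **`iwasawaDatumAdapted_std`** — statement bytes = socket #31p′
`Summit.HodgeConjecture.HodgeConjecture.Cruxes.HLiu418.K2LiuCurveThetaSigsU5dZetaS.sig_K2LiuIwasawaDatumAdaptedStd` (U5d ED. 6) VERBATIM: ★ #31p
`iwasawaDatumAdapted` (for non-degenerate doubled data over a CM field `L` and a finite set `S` of places of `L⁺` off which `H_v = P_{Δ,v}·K_{H,v}`, an
Iwasawa datum `𝒦` with `K^S_H ≤ 𝒦.K`) WITH THE STANDARD SHAPE `𝒦.IsStd` (★ J1(a): product of an archimedean majorant-stabiliser and an OPEN finite level).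

PROOF.  Take the tree's datum WITH SHAPE (★ `exists_subgroup_isStd_shape`: `K₉`, `C_∞`, `C_f`, frame `S_∞`) and ★ #31p's adapted level
`K = {k | (k_∞, (k_v)_{v∈S}) ∈ read-out of K₉, k_v ∈ K_{H,v} (v ∉ S)}` (★ `exists_subgroup_adapted`; compact ★ `isCompact_adapted`; Iwasawa
★ `exists_isSiegelDelta_mul_mem_adapted`; `K^S_H ≤ K` as in ★ #31p).  Its shape: `C_∞` and `S_∞` UNCHANGED, finite level
`C′_f = {u ∈ H(𝔸_f) | (u_v)_{v∈S} ∈ (C_f)_S, u_v ∈ K_{H,v} (v ∉ S)}`: (P0) because `K₉` itself is a product (`k₉ := (k_∞, u₉)` with `u₉ ∈ C_f` is a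
member of `K₉` reading out like `k`; ★ `archPart∕finPart_archToAdelic_mul_finAdelicToAdelic`); (P1) `C′_f = splitPlaces_S⁻¹(pr_S(C_f) × Π_{v∉S} K_{H,v})`
with `pr_S(C_f)` open (image of the open `C_f` under the open projection of the homeomorphism ★ `splitPlaces`) and the box open (★ `isOpen_boxSubgroup`,
★ `isOpen_localInt`); (P2) and the majorant identity are those of `K₉`.

HONEST LABEL.  Count-neutral file of the K2_Liu road; it pays socket #31p′ when tied, not hLiu418: `HC_CM` is proved only modulo the 7 printed
citations (2 remaining named inputs: hLiu418 = `stmt-HodgeConjecture-24832`, h413 = `stmt-HodgeConjecture-24833`) until rung 0 closes.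

## References
* [Tan1999] V. Tan, *Poles of Siegel Eisenstein series on U(n,n)*, Canad. J. Math. 51 (1999): §1 p. 166 (`K = K_∞ ∏ K_v`, standard sections).
* [BorelJacquet1979] A. Borel, H. Jacquet, PSPM 33.1 (1979): §4.1 (`G(𝔸) = G_∞ × G(𝔸_f)`).
* [PlatonovRapinchuk1994] V. Platonov, A. Rapinchuk, *Algebraic Groups and Number Theory* (1994): §5.1 (restricted products, `K = K_S × K^S`).
* [Weil1964] A. Weil, Acta Math. 111 (1964), Chap. I n° 8 (majorants).
-/

set_option autoImplicit false
set_option linter.dupNamespace false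

noncomputable section

open scoped Matrix RestrictedProduct
open Filter Topology Set NumberField IsDedekindDomain NumberField.mixedEmbedding
open Literature.NumberTheory.Automorphic Literature.NumberTheory.Automorphic.UnitaryGroup
open Literature.NumberTheory.GelbartRogawski1991 Literature.NumberTheory.GelbartRogawski1991.GRConstruction
open Literature.NumberTheory.K2Lit.SiegelDoubled Literature.NumberTheory.K2Lit.PlaceSplitting
open Summit.HodgeConjecture.HodgeConjecture.Cruxes.HLiu418.K2LiuIwasawaDatumAdapted
open Summit.HodgeConjecture.HodgeConjecture.Cruxes.HLiu418.K2LiuIwasawaDatumNonemptyStd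

namespace Summit.HodgeConjecture.HodgeConjecture.Cruxes.HLiu418.K2LiuIwasawaDatumAdaptedStd

-- measured 2026-09-04: fails at 200 000 (whnf time-out in the (P0) bookkeeping) and at 400 000 (the `simp only` set identity of (P1)), passes at 1 000 000 — as ★ #31p `isCompact_adapted`;
-- reason (same as there): the socket's `HA`-typed binders vs the datum-typed component homs `archPart`∕`finPart`∕`evalPlace`∕`archToAdelic`∕`finAdelicToAdelic`
-- force default-transparency unification of the two (defeq) group-structure paths at every step
set_option maxHeartbeats 1000000 in
/-- **PAYMENT OF socket #31p′ `sig_K2LiuIwasawaDatumAdaptedStd`** (U5d ED. 6, ruling «M-155j» J2∕J3; statement VERBATIM).  For non-degenerate data and a finite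
`S` off which `H_v = P_{Δ,v}·K_{H,v}`, there is a STANDARD Iwasawa datum `𝒦` (`𝒦.IsStd`) with `K^S_H ≤ 𝒦.K`: the adapted level of ★ #31p over the
tree's datum with shape (★ `exists_subgroup_isStd_shape`); finite level `splitPlaces_S⁻¹(pr_S(C_f) × Π_{v∉S} K_{H,v})`, archimedean part and frame unchanged.
[cite: Tan1999, §1 p. 166] [cite: BorelJacquet1979, §4.1] [cite: PlatonovRapinchuk1994, §5.1] [cite: Weil1964, Chap. I n° 8] -/
theorem iwasawaDatumAdapted_std :
    ∀ (L : Type) [Field L] [NumberField L] [IsCMField L] {N M n : ℕ} (e : Fin N × Fin M ≃ Fin n)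
      (dV : Fin N → L) (hdV : ∀ i, IsCMField.complexConj L (dV i) = dV i) (_hdV0 : ∀ i, dV i ≠ 0)
      (dW : Fin M → L) (hdW : ∀ i, IsCMField.complexConj L (dW i) = dW i) (_hdW0 : ∀ i, dW i ≠ 0)
      (S : Finset (HeightOneSpectrum (𝓞 (Fp L))))
      -- local Iwasawa decomposition `H_v = P_{Δ,v} · K_{H,v}` at every `v ∉ S` (by value; #26∕#27 discharge it at good places)
      (_hIw : ∀ v, v ∉ S → ∀ x : UnitaryGroup.localPi L (IsCMField.complexConj L) (n + n) (hermD L e dV hdV dW hdW) v,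
        ∃ p ∈ siegelDeltaLoc L e dV hdV dW hdW v,
          ∃ k ∈ UnitaryGroup.localInt L (IsCMField.complexConj L) (n + n) (hermD L e dV hdV dW hdW) v, x = p * k),
      ∃ 𝒦 : IwasawaDatum L e dV hdV dW hdW,
        (∀ k : HA L e dV hdV dW hdW,
          UnitaryGroup.archPart (Fp L) L (IsCMField.complexConj L) (n + n) (hermD L e dV hdV dW hdW) k = 1 →
          (∀ v, UnitaryGroup.evalPlace (Fp L) L (IsCMField.complexConj L) (n + n) (hermD L e dV hdV dW hdW) v
              (UnitaryGroup.finPart (Fp L) L (IsCMField.complexConj L) (n + n) (hermD L e dV hdV dW hdW) k) ∈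
            UnitaryGroup.localInt L (IsCMField.complexConj L) (n + n) (hermD L e dV hdV dW hdW) v) →
          (∀ v ∈ S, UnitaryGroup.evalPlace (Fp L) L (IsCMField.complexConj L) (n + n) (hermD L e dV hdV dW hdW) v
              (UnitaryGroup.finPart (Fp L) L (IsCMField.complexConj L) (n + n) (hermD L e dV hdV dW hdW) k) = 1) →
          k ∈ 𝒦.K) ∧ 𝒦.IsStd := by
  intro L _ _ _ N M n e dV hdV hdV0 dW hdW hdW0 S hIw
  classical
  obtain ⟨K₉, Cinf, Cfin, Sfr, hK₉c, hK₉, hP0, hP1, hmaj, hP2⟩ := exists_subgroup_isStd_shape L e dV hdV dW hdW hdV0 hdW0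
  obtain ⟨K, hmemK⟩ := exists_subgroup_adapted L e dV hdV dW hdW K₉ S
  refine ⟨⟨K, isCompact_adapted L e dV hdV dW hdW hK₉c S hmemK, exists_isSiegelDelta_mul_mem_adapted L e dV hdV dW hdW hK₉ hIw hmemK⟩,
    fun k hk1 hk2 hk3 => (hmemK k).2 ⟨⟨1, K₉.one_mem, ?_, fun v => ?_⟩, fun v _ => hk2 v⟩, ?_⟩
  · rw [archPart_one', hk1]
  · rw [finPart_one', map_one, hk3 v.1 v.2]
  -- the STANDARD shape of the adapted level
  -- read-out at the places of `S`
  let evS : UnitaryGroup.finAdelic (Fp L) L (IsCMField.complexConj L) (n + n) (hermD L e dV hdV dW hdW) →*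
      ((v : S) → UnitaryGroup.localPi L (IsCMField.complexConj L) (n + n) (hermD L e dV hdV dW hdW) v.1) :=
    MonoidHom.pi fun v : S => UnitaryGroup.evalPlace (Fp L) L (IsCMField.complexConj L) (n + n) (hermD L e dV hdV dW hdW) v.1
  -- the finite level `C′_f`
  let Cfin' : Subgroup (UnitaryGroup.finAdelic (Fp L) L (IsCMField.complexConj L) (n + n) (hermD L e dV hdV dW hdW)) :=
    (Cfin.map evS).comap evS ⊓
      ⨅ v : {v // v ∉ S}, (UnitaryGroup.localInt L (IsCMField.complexConj L) (n + n) (hermD L e dV hdV dW hdW) v.1).comap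
        (UnitaryGroup.evalPlace (Fp L) L (IsCMField.complexConj L) (n + n) (hermD L e dV hdV dW hdW) v.1)
  have hCfin' : ∀ u : UnitaryGroup.finAdelic (Fp L) L (IsCMField.complexConj L) (n + n) (hermD L e dV hdV dW hdW), u ∈ Cfin' ↔
      (∃ u₉ ∈ Cfin, ∀ v : S, UnitaryGroup.evalPlace (Fp L) L (IsCMField.complexConj L) (n + n) (hermD L e dV hdV dW hdW) v.1 u₉ =
          UnitaryGroup.evalPlace (Fp L) L (IsCMField.complexConj L) (n + n) (hermD L e dV hdV dW hdW) v.1 u) ∧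
        ∀ v : {v // v ∉ S}, UnitaryGroup.evalPlace (Fp L) L (IsCMField.complexConj L) (n + n) (hermD L e dV hdV dW hdW) v.1 u ∈
          UnitaryGroup.localInt L (IsCMField.complexConj L) (n + n) (hermD L e dV hdV dW hdW) v.1 := by
    intro u
    simp only [Cfin', evS, Subgroup.mem_inf, Subgroup.mem_comap, Subgroup.mem_map, Subgroup.mem_iInf, MonoidHom.pi_apply, funext_iff]
  refine ⟨Cinf, Cfin', Sfr, fun k => ?_, ?_, hmaj, hP2⟩
  · -- (P0) the adapted level is a product (because `K₉` is)
    rw [hmemK, hCfin']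
    constructor
    · rintro ⟨⟨k₉, hk₉, hka, hkS⟩, hkint⟩
      obtain ⟨h9a, h9f⟩ := (hP0 k₉).1 hk₉
      exact ⟨hka ▸ h9a, ⟨_, h9f, hkS⟩, fun v => hkint v.1 v.2⟩
    · rintro ⟨hka, ⟨u₉, hu₉, huS⟩, hkint⟩
      refine ⟨⟨archToAdelic (Fp L) L (IsCMField.complexConj L) (n + n) (hermD L e dV hdV dW hdW)
          (UnitaryGroup.archPart (Fp L) L (IsCMField.complexConj L) (n + n) (hermD L e dV hdV dW hdW) k) *
        finAdelicToAdelic (Fp L) L (IsCMField.complexConj L) (n + n) (hermD L e dV hdV dW hdW) u₉, (hP0 _).2 ⟨?_, ?_⟩, ?_, fun v => ?_⟩,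
        fun v hv => hkint ⟨v, hv⟩⟩
      · rw [archPart_archToAdelic_mul_finAdelicToAdelic]
        exact hka
      · rw [finPart_archToAdelic_mul_finAdelicToAdelic]
        exact hu₉
      · rw [archPart_archToAdelic_mul_finAdelicToAdelic]
      · rw [finPart_archToAdelic_mul_finAdelicToAdelic]
        exact huS v
  · -- (P1) `C′_f = splitPlaces_S⁻¹(pr_S(C_f) × box)` is open
    set σS := splitPlaces (Fp L) L (IsCMField.complexConj L) (n + n) (hermD L e dV hdV dW hdW) S with hσS
    have hpr : IsOpenMap fun u : UnitaryGroup.finAdelic (Fp L) L (IsCMField.complexConj L) (n + n) (hermD L e dV hdV dW hdW) => (σS u).1 :=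
      isOpenMap_fst.comp σS.isOpenMap
    have hT : IsOpen ((fun u : UnitaryGroup.finAdelic (Fp L) L (IsCMField.complexConj L) (n + n) (hermD L e dV hdV dW hdW) => (σS u).1) ''
        (Cfin : Set (UnitaryGroup.finAdelic (Fp L) L (IsCMField.complexConj L) (n + n) (hermD L e dV hdV dW hdW)))) := hpr _ hP1
    have hB : IsOpen (boxSubgroup (K := fun v : {v // v ∉ S} => UnitaryGroup.localInt L (IsCMField.complexConj L) (n + n) (hermD L e dV hdV dW hdW) v.1)
        (fun v : {v // v ∉ S} => UnitaryGroup.localInt L (IsCMField.complexConj L) (n + n) (hermD L e dV hdV dW hdW) v.1) :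
          Set (Πʳ v : {v // v ∉ S}, [UnitaryGroup.localPi L (IsCMField.complexConj L) (n + n) (hermD L e dV hdV dW hdW) v.1,
            UnitaryGroup.localInt L (IsCMField.complexConj L) (n + n) (hermD L e dV hdV dW hdW) v.1])) :=
      isOpen_boxSubgroup (fun v => isOpen_localInt L (IsCMField.complexConj L) (n + n) (hermD L e dV hdV dW hdW) v.1)
        (Filter.Eventually.of_forall fun _ => le_rfl)
    have hset : (Cfin' : Set (UnitaryGroup.finAdelic (Fp L) L (IsCMField.complexConj L) (n + n) (hermD L e dV hdV dW hdW))) =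
        σS ⁻¹' (((fun u : UnitaryGroup.finAdelic (Fp L) L (IsCMField.complexConj L) (n + n) (hermD L e dV hdV dW hdW) => (σS u).1) ''
            (Cfin : Set (UnitaryGroup.finAdelic (Fp L) L (IsCMField.complexConj L) (n + n) (hermD L e dV hdV dW hdW)))) ×ˢ
          (boxSubgroup (K := fun v : {v // v ∉ S} => UnitaryGroup.localInt L (IsCMField.complexConj L) (n + n) (hermD L e dV hdV dW hdW) v.1)
            (fun v : {v // v ∉ S} => UnitaryGroup.localInt L (IsCMField.complexConj L) (n + n) (hermD L e dV hdV dW hdW) v.1) :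
            Set (Πʳ v : {v // v ∉ S}, [UnitaryGroup.localPi L (IsCMField.complexConj L) (n + n) (hermD L e dV hdV dW hdW) v.1,
              UnitaryGroup.localInt L (IsCMField.complexConj L) (n + n) (hermD L e dV hdV dW hdW) v.1]))) := by
      ext u
      simp only [SetLike.mem_coe, hCfin', Set.mem_preimage, Set.mem_prod, Set.mem_image, mem_boxSubgroup_iff, hσS, splitPlaces_snd_apply,
        funext_iff, splitPlaces_fst_apply]
    rw [hset]
    exact (hT.prod hB).preimage σS.continuous

end Summit.HodgeConjecture.HodgeConjecture.Cruxes.HLiu418.K2LiuIwasawaDatumAdaptedStd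

end
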